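import Summits.HubbardSuperconductivity.HubbardSuperconductivity.Theorems.BalabanIRBirEveryGroundStateSpectralCurve
import Literature.Computability.AlgebraicComplexity.SubspaceProjection

/-!
# Route `BalabanIR`, crux `BirEveryGroundState` (`stmt-HubbardSuperconductivity-2083`), line
# `spectral-curve-anchor`: the SECTOR SPECTRAL CURVE (stub `stub_sectorSpectralCurve`)

For Hermitian matrices `T, D` over `ℂ` preserving a subspace `K ≤ ℂⁿ` (a particle-number /
spin sector of a Hubbard Hamiltonian pencil `T + u D`), the spectral curve of the pencil
restricted to `K` is the characteristic polynomial `χ(u, λ) = det (λ - Bᴴ (T + u D) B)` of the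
compression to an orthonormal frame `B` of `K` (`exists_orthonormalFrame`), an element of
`ℂ[u][λ] = ℂ[X][X]`. This file proves the dictionary registered as the stub
`stub_sectorSpectralCurve` of the line skeleton:

* `χ` is monic (`Matrix.charpoly_monic`);
* the specialised roots of `χ` at a complex coupling `u` are exactly the eigenvalues of
  `T + u D` carried by an eigenvector in `K` (`charpoly_pencil_map_evalRingHom`,
  `Matrix.eval_charpoly`, `Matrix.exists_mulVec_eq_zero_iff`, and the frame transport
  `x ↦ B x`, `v ↦ Bᴴ v`);
* at real couplings and real energies the root multiplicity is the dimension of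
  `K ⊓ eigenspace` (`IsHermitian.rootMultiplicity_charpoly_eq_finrank_eigenspace` for the
  Hermitian compression, and a linear equivalence of eigenspaces along the frame);
* every specialised root lies on an irreducible factor of `χ` (`ℂ[u][λ]` is a UFD; induction on
  irreducible factorisations, `WfDvdMonoid.induction_on_irreducible`).

Folklore linear algebra (Kato, *Perturbation Theory for Linear Operators* (1966) II §1);
no definition is introduced.
-/

noncomputable section

namespace Summit.HubbardSuperconductivity.HubbardSuperconductivity.Theorems

open Polynomial Matrix
open scoped Polynomial
open Literature.Computability.AlgebraicComplexity

section Frame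

variable {n : Type} [Fintype n] {k : ℕ} {B : Matrix n (Fin k) ℂ} {K : Submodule ℂ (n → ℂ)}

/-- `Bᴴ (B x) = x` for a matrix `B` with orthonormal columns. [folklore] -/
private theorem frame_conjTranspose_mulVec_mulVec (hBB : Bᴴ * B = 1) (x : Fin k → ℂ) :
    Bᴴ *ᵥ (B *ᵥ x) = x := by
  rw [mulVec_mulVec, hBB, one_mulVec]

/-- A frame with columns in `K` maps coordinate vectors into `K`: `B x ∈ K`. [folklore] -/
private theorem frame_mulVec_mem (hBB : Bᴴ * B = 1) (hcol : ∀ j, (fun i => B i j) ∈ K)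
    (x : Fin k → ℂ) : B *ᵥ x ∈ K := by
  have h := frame_proj_mulVec_mem hcol (B *ᵥ x)
  rwa [← mulVec_mulVec, frame_conjTranspose_mulVec_mulVec hBB] at h

/-- Compression transport: if `M` preserves `K`, then `M (B x) = B ((Bᴴ M B) x)` for an
orthonormal frame `B` of `K`. [folklore] -/
private theorem frame_mulVec_compress (hBB : Bᴴ * B = 1) (hcol : ∀ j, (fun i => B i j) ∈ K)
    (hfix : ∀ w ∈ K, (B * Bᴴ) *ᵥ w = w) {M : Matrix n n ℂ} (hMK : ∀ v ∈ K, M *ᵥ v ∈ K)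
    (x : Fin k → ℂ) : M *ᵥ (B *ᵥ x) = B *ᵥ ((Bᴴ * M * B) *ᵥ x) := by
  have hmem : M *ᵥ (B *ᵥ x) ∈ K := hMK _ (frame_mulVec_mem hBB hcol x)
  conv_lhs => rw [← hfix _ hmem]
  simp only [mulVec_mulVec, Matrix.mul_assoc]

/-- Eigen-dictionary along an orthonormal frame `B` of `K`: the compression `Bᴴ M B` has an
eigenvector with eigenvalue `μ` iff `M` has one inside `K` (for `M` preserving `K`).
[folklore] -/
private theorem frame_exists_eigenvector_iff (hBB : Bᴴ * B = 1)
    (hcol : ∀ j, (fun i => B i j) ∈ K) (hfix : ∀ w ∈ K, (B * Bᴴ) *ᵥ w = w) {M : Matrix n n ℂ}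
    (hMK : ∀ v ∈ K, M *ᵥ v ∈ K) (μ : ℂ) :
    (∃ x : Fin k → ℂ, x ≠ 0 ∧ (Bᴴ * M * B) *ᵥ x = μ • x) ↔
      ∃ v ∈ K, v ≠ 0 ∧ M *ᵥ v = μ • v := by
  constructor
  · rintro ⟨x, hx, hMx⟩
    refine ⟨B *ᵥ x, frame_mulVec_mem hBB hcol x, fun h0 => hx ?_, ?_⟩
    · have h := frame_conjTranspose_mulVec_mulVec hBB x
      rw [h0, mulVec_zero] at h
      exact h.symm
    · rw [frame_mulVec_compress hBB hcol hfix hMK, hMx, mulVec_smul]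
  · rintro ⟨v, hv, hv0, hMv⟩
    refine ⟨Bᴴ *ᵥ v, fun h0 => hv0 ?_, ?_⟩
    · have h := hfix v hv
      rw [← mulVec_mulVec, h0, mulVec_zero] at h
      exact h.symm
    · rw [← mulVec_mulVec, ← mulVec_mulVec, mulVec_mulVec v B Bᴴ, hfix v hv, hMv, mulVec_smul]

variable [DecidableEq n]

/-- Along an orthonormal frame `B` of `K`, the eigenspace of the compression `Bᴴ M B` at `μ`
is linearly equivalent to `K ⊓ eigenspace M μ` (for `M` preserving `K`); in particular the
dimensions agree. [folklore] -/
private theorem frame_finrank_eigenspace_compress (hBB : Bᴴ * B = 1)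
    (hcol : ∀ j, (fun i => B i j) ∈ K) (hfix : ∀ w ∈ K, (B * Bᴴ) *ᵥ w = w) {M : Matrix n n ℂ}
    (hMK : ∀ v ∈ K, M *ᵥ v ∈ K) (μ : ℂ) :
    Module.finrank ℂ ↥(Module.End.eigenspace (Matrix.toLin' (Bᴴ * M * B)) μ) =
      Module.finrank ℂ ↥(K ⊓ Module.End.eigenspace (Matrix.toLin' M) μ) := by
  have hfwd : ∀ x ∈ Module.End.eigenspace (Matrix.toLin' (Bᴴ * M * B)) μ,
      B *ᵥ x ∈ K ⊓ Module.End.eigenspace (Matrix.toLin' M) μ := by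
    intro x hx
    rw [Module.End.mem_eigenspace_iff, Matrix.toLin'_apply] at hx
    refine Submodule.mem_inf.mpr ⟨frame_mulVec_mem hBB hcol x, ?_⟩
    rw [Module.End.mem_eigenspace_iff, Matrix.toLin'_apply,
      frame_mulVec_compress hBB hcol hfix hMK, hx, mulVec_smul]
  have hbwd : ∀ v ∈ K ⊓ Module.End.eigenspace (Matrix.toLin' M) μ,
      Bᴴ *ᵥ v ∈ Module.End.eigenspace (Matrix.toLin' (Bᴴ * M * B)) μ := by
    intro v hv
    obtain ⟨hvK, hvE⟩ := Submodule.mem_inf.mp hv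
    rw [Module.End.mem_eigenspace_iff, Matrix.toLin'_apply] at hvE ⊢
    rw [← mulVec_mulVec, ← mulVec_mulVec, mulVec_mulVec v B Bᴴ, hfix v hvK, hvE, mulVec_smul]
  let e : ↥(Module.End.eigenspace (Matrix.toLin' (Bᴴ * M * B)) μ) ≃ₗ[ℂ]
      ↥(K ⊓ Module.End.eigenspace (Matrix.toLin' M) μ) :=
    { toFun := fun x => ⟨B *ᵥ (x : Fin k → ℂ), hfwd x x.2⟩
      map_add' := fun x y => by
        ext1
        simp only [Submodule.coe_add, mulVec_add]
      map_smul' := fun c x => by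
        ext1
        simp only [Submodule.coe_smul, mulVec_smul, RingHom.id_apply]
      invFun := fun v => ⟨Bᴴ *ᵥ (v : n → ℂ), hbwd v v.2⟩
      left_inv := fun x => Subtype.ext (frame_conjTranspose_mulVec_mulVec hBB _)
      right_inv := fun v => Subtype.ext (by
        show B *ᵥ (Bᴴ *ᵥ (v : n → ℂ)) = v
        rw [mulVec_mulVec]
        exact hfix _ (Submodule.mem_inf.mp v.2).1) }
  exact e.finrank_eq

end Frame

/-- The scalar matrix acts by scalar multiplication: `(scalar m a) v = a • v`. [folklore] -/
private theorem scalar_mulVec_eq_smul {m : Type*} [Fintype m] [DecidableEq m] (a : ℂ)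
    (v : m → ℂ) : scalar m a *ᵥ v = a • v := by
  ext i
  simp [scalar_apply, mulVec_diagonal]

/-- In the UFD `ℂ[u][λ]`, a specialised root of a nonzero `χ` is a specialised root of one of
its irreducible factors (a root of a product is a root of a factor; induction on an
irreducible factorisation). [folklore] -/
private theorem exists_irreducible_dvd_of_isRoot_map {χ : ℂ[X][X]} (hχ : χ ≠ 0) {u μ : ℂ}
    (hroot : (χ.map (evalRingHom u)).IsRoot μ) :
    ∃ p : ℂ[X][X], Irreducible p ∧ p ∣ χ ∧ (p.map (evalRingHom u)).IsRoot μ := by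
  induction χ using WfDvdMonoid.induction_on_irreducible with
  | zero => exact (hχ rfl).elim
  | unit a ha =>
    obtain ⟨r, hr, rfl⟩ := Polynomial.isUnit_iff.mp ha
    obtain ⟨s, hs, rfl⟩ := Polynomial.isUnit_iff.mp hr
    rw [map_C, IsRoot.def, eval_C, coe_evalRingHom, eval_C] at hroot
    exact (hs.ne_zero hroot).elim
  | mul a i ha hi ih =>
    rw [Polynomial.map_mul, IsRoot.def, eval_mul, mul_eq_zero] at hroot
    rcases hroot with h | h
    · exact ⟨i, hi, dvd_mul_right i a, h⟩
    · obtain ⟨p, hp, hpa, hpr⟩ := ih ha h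
      exact ⟨p, hp, hpa.mul_left i, hpr⟩

set_option linter.dupNamespace false in
/-- **The sector spectral curve** (stub `stub_sectorSpectralCurve` of the line
`spectral-curve-anchor`). For Hermitian `T, D` preserving a subspace `K`, there is a monic
`χ ∈ ℂ[u][λ]` — the characteristic polynomial of the pencil `T + u D` compressed to an
orthonormal frame of `K` — whose specialised roots at `u` are exactly the eigenvalues of
`T + u D` with an eigenvector in `K`, whose real root multiplicities at real couplings are the
dimensions of `K ⊓ eigenspace`, and each of whose specialised roots lies on an irreducible
factor (UFD). [folklore] -/
theorem stub_sectorSpectralCurve {n : Type} [Fintype n] [DecidableEq n] (T D : Matrix n n ℂ)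
    (hT : T.IsHermitian) (hD : D.IsHermitian) (K : Submodule ℂ (n → ℂ))
    (hTK : ∀ v ∈ K, T *ᵥ v ∈ K) (hDK : ∀ v ∈ K, D *ᵥ v ∈ K) :
    ∃ χ : ℂ[X][X], χ.Monic ∧
      (∀ u μ : ℂ, (χ.map (evalRingHom u)).IsRoot μ ↔ ∃ v ∈ K, v ≠ 0 ∧ (T + u • D) *ᵥ v = μ • v) ∧
      (∀ U μ : ℝ, (χ.map (evalRingHom (U : ℂ))).rootMultiplicity (μ : ℂ) =
        Module.finrank ℂ ↥(K ⊓ Module.End.eigenspace (Matrix.toLin' (T + (U : ℂ) • D)) (μ : ℂ))) ∧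
      (∀ u μ : ℂ, (χ.map (evalRingHom u)).IsRoot μ →
        ∃ p : ℂ[X][X], Irreducible p ∧ p ∣ χ ∧ (p.map (evalRingHom u)).IsRoot μ) := by
  obtain ⟨k, B, -, hBB, hcol, hfix⟩ := exists_orthonormalFrame K
  -- the pencil preserves `K`
  have hMK : ∀ u : ℂ, ∀ v ∈ K, (T + u • D) *ᵥ v ∈ K := fun u v hv => by
    rw [add_mulVec, smul_mulVec]
    exact K.add_mem (hTK v hv) (K.smul_mem u (hDK v hv))
  -- real couplings give Hermitian members of the pencil
  have hH : ∀ U : ℝ, (T + (U : ℂ) • D).IsHermitian := fun U => by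
    refine hT.add ?_
    have : ((U : ℂ) • D)ᴴ = (U : ℂ) • D := by
      rw [conjTranspose_smul, hD.eq, Complex.star_def, Complex.conj_ofReal]
    exact this
  -- the compressed pencil and its specialisations
  have hpen : ∀ u : ℂ, Bᴴ * T * B + u • (Bᴴ * D * B) = Bᴴ * (T + u • D) * B := fun u => by
    rw [Matrix.mul_add, Matrix.add_mul, Matrix.mul_smul, Matrix.smul_mul]
  have hχu : ∀ u : ℂ, ((Bᴴ * T * B).map C + (X : ℂ[X]) • (Bᴴ * D * B).map C).charpoly.map
      (evalRingHom u) = (Bᴴ * (T + u • D) * B).charpoly := fun u => by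
    rw [charpoly_pencil_map_evalRingHom, hpen]
  -- roots = eigenvalues carried by `K`
  have hroots : ∀ u μ : ℂ, ((((Bᴴ * T * B).map C + (X : ℂ[X]) • (Bᴴ * D * B).map C).charpoly.map
      (evalRingHom u)).IsRoot μ ↔ ∃ v ∈ K, v ≠ 0 ∧ (T + u • D) *ᵥ v = μ • v) := fun u μ => by
    rw [hχu, ← frame_exists_eigenvector_iff hBB hcol hfix (hMK u) μ, IsRoot.def, eval_charpoly,
      ← Matrix.exists_mulVec_eq_zero_iff]
    refine exists_congr fun x => and_congr Iff.rfl ?_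
    rw [sub_mulVec, scalar_mulVec_eq_smul, sub_eq_zero, eq_comm]
  refine ⟨_, Matrix.charpoly_monic _, hroots, fun U μ => ?_, fun u μ hroot => ?_⟩
  · -- multiplicities = dimensions of `K ⊓ eigenspace`
    rw [hχu, IsHermitian.rootMultiplicity_charpoly_eq_finrank_eigenspace
      (isHermitian_conjTranspose_mul_mul B (hH U)) μ,
      frame_finrank_eigenspace_compress hBB hcol hfix (hMK (U : ℂ)) (μ : ℂ)]
  · -- every specialised root lies on an irreducible factor
    exact exists_irreducible_dvd_of_isRoot_map (Matrix.charpoly_monic _).ne_zero hroot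

end Summit.HubbardSuperconductivity.HubbardSuperconductivity.Theorems
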